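import Summits.CriticalPhenomena.PercolationContinuityZ3.Theorems.PercNearOneGluingNoHeavyConstsTwoPoleCore
import HarnessLib

/-!
# The two-pole core WITH AN EXTERNAL BRIDGE: polynomial inequalities for TS / DUU when further `u–v` bridges may merge the poles

builds on p205010 (kernel theorem, internal audit signed; external expert review pending)

Lane `prim/consts`, seat prim-consts-1 gen 12 (memo `FROM-prim-consts-1-g12-TWO-POLE.md` §3).  Helper file for the crux `NoHeavyLowerTail`
(stmt-CriticalPhenomena-4575; `--supports`): theorems only, no definitions, no sorries, standard axioms.  Extends `…ConstsTwoPoleCore`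
(the case `g = 0`); consumed by `…ConstsTripleSplitTwoPoleBridge`.

SETTING.  As in `…ConstsTwoPoleCore` (terminal `i ∈ {0,1,2}` reaches pole `u` with probability `xᵢ`, pole `v` with `yᵢ`, independently), plus an
independent EXTERNAL BRIDGE event `G` of probability `g` merging the poles (any structure between `u` and `v` avoiding the three branches).
With `nᵢ = (1−xᵢ)(1−yᵢ)`, `q = n₁n₂`, `N = n₁ + n₂ − n₁n₂` and the `g = 0` quantities `S_x, S_y, D_x, D_y, M` of the core:
`μ(0|1|2) ≤ A(g) = (1−g)S_xS_y + g·S_n`,  `S_n = n₀n₁ + n₀n₂ + n₁n₂ − 2n₀n₁n₂`  (merged: at most one terminal attached);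
`μ(0 ↮ 1, 0 ↮ 2) ≥ B(g) = (1−g)D_xD_y + g·(n₀ + (1−n₀)q)`;  `μ(1 ↮ 2) ≥ C(g) = (1−g)M + g·N`.
DUU(root 0) becomes `A(g)² ≤ B(g)·C(g)²` (`Consts.TwoPole.poly_DUU_bridge`), interpolating between `…poly_DUU` (`g = 0`) and the star
inequality of `Consts.rootedSplit_star` (`g = 1`, hub = the merged pole).  Conditioning on `G` and Cauchy–Schwarz provably loses (Jensen gap
`g(1−g)(M−N)²` at the tight point `x₀ = y₀ = 0`); instead:
(1) Cauchy–Schwarz over the ROOT's four pole states only, with the `G`-mixture kept inside each state (`Consts.TwoPole.cs_atoms₄`,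
    `Consts.TwoPole.bridge_cs`):  `A(g)² ≤ B(g)·Λ(g)`,  `Λ(g) = n₀τ² + x₀(1−y₀)((1−g)X'Y² + gq) + (1−x₀)y₀((1−g)X²Y' + gq) + x₀y₀q`,
    `τ = (1−g)XY + gN`;
(2) `Λ(g) ≤ C(g)²` COEFFICIENTWISE IN `g` (`Consts.TwoPole.bridge_key_le`):  `C(g)² − Λ(g) = (1−g)²·P₀ + g(1−g)·P₀₁ + g²·P₁` with `P₀ = M² − L_xL_y ≥ 0`
    (`Consts.TwoPole.key_le`), `P₁ = (1−n₀)(N² − q) ≥ 0`, and the MIXED term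
    `P₀₁ = x₀(1−y₀)[(Y²(X²−X') − c²) + (N² − q)] + y₀(1−x₀)[(X²(Y²−Y') − c²) + (N² − q)] + 2x₀y₀(N² − q) ≥ 0`
    (`Consts.TwoPole.cross_sq_le`; the identity `2XYN − X'Y² − q = (Y²(X²−X') − c²) + (N² − q)` is `Consts.TwoPole.bridge_two_XYN`).
All identities were verified in exact arithmetic (eng/verify_bridge.py) before formalisation.
References: G. Grimmett, *Percolation* (1999), §1.3, §2.2.
-/

namespace Summit.CriticalPhenomena.PercolationContinuityZ3.Theorems

open MeasureTheory Set Literature.Probability.LatticeModels Literature.Probability.Percolation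
open scoped Classical

namespace Consts

namespace TwoPole

/-- **Cauchy–Schwarz for four weighted atoms**: `(Σ Wᵢaᵢ)² ≤ (Σ Wᵢ)(Σ Wᵢaᵢ²)` for `Wᵢ ≥ 0` (the difference is `Σ_{i<j} WᵢWⱼ(aᵢ − aⱼ)²`). [folklore] -/
theorem cs_atoms₄ (W₁ W₂ W₃ W₄ a₁ a₂ a₃ a₄ : ℝ) (h₁ : 0 ≤ W₁) (h₂ : 0 ≤ W₂) (h₃ : 0 ≤ W₃) (h₄ : 0 ≤ W₄) :
    (W₁ * a₁ + W₂ * a₂ + W₃ * a₃ + W₄ * a₄) ^ 2 ≤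
      (W₁ + W₂ + W₃ + W₄) * (W₁ * a₁ ^ 2 + W₂ * a₂ ^ 2 + W₃ * a₃ ^ 2 + W₄ * a₄ ^ 2) := by
  have e : (W₁ + W₂ + W₃ + W₄) * (W₁ * a₁ ^ 2 + W₂ * a₂ ^ 2 + W₃ * a₃ ^ 2 + W₄ * a₄ ^ 2) -
      (W₁ * a₁ + W₂ * a₂ + W₃ * a₃ + W₄ * a₄) ^ 2 =
      W₁ * W₂ * (a₁ - a₂) ^ 2 + W₁ * W₃ * (a₁ - a₃) ^ 2 + W₁ * W₄ * (a₁ - a₄) ^ 2 + W₂ * W₃ * (a₂ - a₃) ^ 2 +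
        W₂ * W₄ * (a₂ - a₄) ^ 2 + W₃ * W₄ * (a₃ - a₄) ^ 2 := by ring
  have : 0 ≤ W₁ * W₂ * (a₁ - a₂) ^ 2 + W₁ * W₃ * (a₁ - a₃) ^ 2 + W₁ * W₄ * (a₁ - a₄) ^ 2 + W₂ * W₃ * (a₂ - a₃) ^ 2 +
      W₂ * W₄ * (a₂ - a₄) ^ 2 + W₃ * W₄ * (a₃ - a₄) ^ 2 := by positivity
  linarith

/-- **The mixed-coefficient identity.**  For `x₁, x₂, y₁, y₂ ∈ [0,1]`, with `X = 1−x₁x₂`, `X' = (1−x₁)(1−x₂)`, `Y = 1−y₁y₂`, `nᵢ = (1−xᵢ)(1−yᵢ)`,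
`q = n₁n₂`, `N = n₁ + n₂ − q` and the cross term `c` of `Consts.TwoPole.cross_sq_le`:  `X'Y² + q ≤ 2XYN`, because
`2XYN − X'Y² − q = (Y²(X² − X') − c²) + (N² − q)` and both brackets are nonnegative. [folklore] -/
theorem bridge_two_XYN (x₁ x₂ y₁ y₂ : ℝ) (hx₁ : 0 ≤ x₁) (hx₁' : x₁ ≤ 1) (hx₂ : 0 ≤ x₂) (hx₂' : x₂ ≤ 1)
    (hy₁ : 0 ≤ y₁) (hy₁' : y₁ ≤ 1) (hy₂ : 0 ≤ y₂) (hy₂' : y₂ ≤ 1) :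
    (1 - x₁) * (1 - x₂) * (1 - y₁ * y₂) ^ 2 + (1 - x₁) * (1 - y₁) * ((1 - x₂) * (1 - y₂)) ≤
      2 * ((1 - x₁ * x₂) * (1 - y₁ * y₂)) *
        ((1 - x₁) * (1 - y₁) + (1 - x₂) * (1 - y₂) - (1 - x₁) * (1 - y₁) * ((1 - x₂) * (1 - y₂))) := by
  set c : ℝ := x₁ * (1 - y₁) * (1 - x₂) * y₂ + (1 - x₁) * y₁ * x₂ * (1 - y₂) with hc_def
  set n₁ : ℝ := (1 - x₁) * (1 - y₁) with hn₁
  set n₂ : ℝ := (1 - x₂) * (1 - y₂) with hn₂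
  have hA := cross_sq_le x₁ x₂ y₁ y₂ hx₁ hx₁' hx₂ hx₂' hy₁ hy₁' hy₂ hy₂'
  have hn₁0 : 0 ≤ n₁ := mul_nonneg (sub_nonneg.2 hx₁') (sub_nonneg.2 hy₁')
  have hn₂0 : 0 ≤ n₂ := mul_nonneg (sub_nonneg.2 hx₂') (sub_nonneg.2 hy₂')
  have hn₁1 : n₁ ≤ 1 := by rw [hn₁]; exact mul_le_one₀ (sub_le_self _ hx₁) (sub_nonneg.2 hy₁') (sub_le_self _ hy₁)
  have hn₂1 : n₂ ≤ 1 := by rw [hn₂]; exact mul_le_one₀ (sub_le_self _ hx₂) (sub_nonneg.2 hy₂') (sub_le_self _ hy₂)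
  have hN₁ : n₁ ≤ n₁ + n₂ - n₁ * n₂ := by
    have h := mul_nonneg hn₂0 (sub_nonneg.2 hn₁1); have e : n₂ * (1 - n₁) = n₂ - n₁ * n₂ := by ring
    linarith
  have hN₂ : n₂ ≤ n₁ + n₂ - n₁ * n₂ := by
    have h := mul_nonneg hn₁0 (sub_nonneg.2 hn₂1); have e : n₁ * (1 - n₂) = n₁ - n₁ * n₂ := by ring
    linarith
  have hNN : n₁ * n₂ ≤ (n₁ + n₂ - n₁ * n₂) ^ 2 := by rw [sq]; exact mul_le_mul hN₁ hN₂ hn₂0 (hn₁0.trans hN₁)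
  have ident : 2 * ((1 - x₁ * x₂) * (1 - y₁ * y₂)) * (n₁ + n₂ - n₁ * n₂) - ((1 - x₁) * (1 - x₂) * (1 - y₁ * y₂) ^ 2 + n₁ * n₂) =
      ((1 - y₁ * y₂) ^ 2 * ((1 - x₁ * x₂) ^ 2 - (1 - x₁) * (1 - x₂)) - c ^ 2) + ((n₁ + n₂ - n₁ * n₂) ^ 2 - n₁ * n₂) := by
    rw [hn₁, hn₂, hc_def]; ring
  linarith

/-- **The refined key inequality with an external bridge**: `Λ(g) ≤ C(g)²` (notation of the module docstring), for all variables in `[0,1]`.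
Coefficientwise in `g`: `(1−g)²·(M² − L_xL_y) + g(1−g)·P₀₁ + g²·(1−n₀)(N² − q)`. [folklore] -/
theorem bridge_key_le (x₀ x₁ x₂ y₀ y₁ y₂ g : ℝ) (hx₀ : 0 ≤ x₀) (hx₀' : x₀ ≤ 1) (hx₁ : 0 ≤ x₁) (hx₁' : x₁ ≤ 1) (hx₂ : 0 ≤ x₂)
    (hx₂' : x₂ ≤ 1) (hy₀ : 0 ≤ y₀) (hy₀' : y₀ ≤ 1) (hy₁ : 0 ≤ y₁) (hy₁' : y₁ ≤ 1) (hy₂ : 0 ≤ y₂) (hy₂' : y₂ ≤ 1) (hg : 0 ≤ g)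
    (hg' : g ≤ 1) :
    (1 - x₀) * (1 - y₀) * ((1 - g) * ((1 - x₁ * x₂) * (1 - y₁ * y₂)) +
          g * ((1 - x₁) * (1 - y₁) + (1 - x₂) * (1 - y₂) - (1 - x₁) * (1 - y₁) * ((1 - x₂) * (1 - y₂)))) ^ 2 +
        x₀ * (1 - y₀) * ((1 - g) * ((1 - x₁) * (1 - x₂) * (1 - y₁ * y₂) ^ 2) + g * ((1 - x₁) * (1 - y₁) * ((1 - x₂) * (1 - y₂)))) +
        (1 - x₀) * y₀ * ((1 - g) * ((1 - x₁ * x₂) ^ 2 * ((1 - y₁) * (1 - y₂))) + g * ((1 - x₁) * (1 - y₁) * ((1 - x₂) * (1 - y₂)))) +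
        x₀ * y₀ * ((1 - x₁) * (1 - y₁) * ((1 - x₂) * (1 - y₂))) ≤
      ((1 - g) * ((1 - x₁ * x₂) * (1 - y₁ * y₂) - x₀ * y₀ * (x₁ * (1 - y₁) * (1 - x₂) * y₂ + (1 - x₁) * y₁ * x₂ * (1 - y₂))) +
        g * ((1 - x₁) * (1 - y₁) + (1 - x₂) * (1 - y₂) - (1 - x₁) * (1 - y₁) * ((1 - x₂) * (1 - y₂)))) ^ 2 := by
  set c : ℝ := x₁ * (1 - y₁) * (1 - x₂) * y₂ + (1 - x₁) * y₁ * x₂ * (1 - y₂) with hc_def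
  set n₁ : ℝ := (1 - x₁) * (1 - y₁) with hn₁
  set n₂ : ℝ := (1 - x₂) * (1 - y₂) with hn₂
  set X : ℝ := 1 - x₁ * x₂ with hX
  set Y : ℝ := 1 - y₁ * y₂ with hY
  set X' : ℝ := (1 - x₁) * (1 - x₂) with hX'
  set Y' : ℝ := (1 - y₁) * (1 - y₂) with hY'
  -- the three coefficient inequalities
  have hP0 := key_le x₀ x₁ x₂ y₀ y₁ y₂ hx₀ hx₀' hx₁ hx₁' hx₂ hx₂' hy₀ hy₀' hy₁ hy₁' hy₂ hy₂'
  have hXYN := bridge_two_XYN x₁ x₂ y₁ y₂ hx₁ hx₁' hx₂ hx₂' hy₁ hy₁' hy₂ hy₂'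
  have hXYN' : (1 - y₁) * (1 - y₂) * (1 - x₁ * x₂) ^ 2 + (1 - y₁) * (1 - x₁) * ((1 - y₂) * (1 - x₂)) ≤
      2 * ((1 - y₁ * y₂) * (1 - x₁ * x₂)) *
        ((1 - y₁) * (1 - x₁) + (1 - y₂) * (1 - x₂) - (1 - y₁) * (1 - x₁) * ((1 - y₂) * (1 - x₂))) :=
    bridge_two_XYN y₁ y₂ x₁ x₂ hy₁ hy₁' hy₂ hy₂' hx₁ hx₁' hx₂ hx₂'
  have hn₁0 : 0 ≤ n₁ := mul_nonneg (sub_nonneg.2 hx₁') (sub_nonneg.2 hy₁')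
  have hn₂0 : 0 ≤ n₂ := mul_nonneg (sub_nonneg.2 hx₂') (sub_nonneg.2 hy₂')
  have hn₁1 : n₁ ≤ 1 := by rw [hn₁]; exact mul_le_one₀ (sub_le_self _ hx₁) (sub_nonneg.2 hy₁') (sub_le_self _ hy₁)
  have hn₂1 : n₂ ≤ 1 := by rw [hn₂]; exact mul_le_one₀ (sub_le_self _ hx₂) (sub_nonneg.2 hy₂') (sub_le_self _ hy₂)
  have hN₁ : n₁ ≤ n₁ + n₂ - n₁ * n₂ := by
    have h := mul_nonneg hn₂0 (sub_nonneg.2 hn₁1); have e : n₂ * (1 - n₁) = n₂ - n₁ * n₂ := by ring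
    linarith
  have hN₂ : n₂ ≤ n₁ + n₂ - n₁ * n₂ := by
    have h := mul_nonneg hn₁0 (sub_nonneg.2 hn₂1); have e : n₁ * (1 - n₂) = n₁ - n₁ * n₂ := by ring
    linarith
  have hNN : n₁ * n₂ ≤ (n₁ + n₂ - n₁ * n₂) ^ 2 := by rw [sq]; exact mul_le_mul hN₁ hN₂ hn₂0 (hn₁0.trans hN₁)
  have hn₀' : 0 ≤ 1 - (1 - x₀) * (1 - y₀) := sub_nonneg.2 (mul_le_one₀ (sub_le_self _ hx₀) (sub_nonneg.2 hy₀') (sub_le_self _ hy₀))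
  -- the decomposition `C(g)² − Λ(g) = (1−g)² P₀ + g(1−g) P₀₁ + g² P₁`
  have ident : ((1 - g) * (X * Y - x₀ * y₀ * c) + g * (n₁ + n₂ - n₁ * n₂)) ^ 2 -
      ((1 - x₀) * (1 - y₀) * ((1 - g) * (X * Y) + g * (n₁ + n₂ - n₁ * n₂)) ^ 2 +
        x₀ * (1 - y₀) * ((1 - g) * (X' * Y ^ 2) + g * (n₁ * n₂)) + (1 - x₀) * y₀ * ((1 - g) * (X ^ 2 * Y') + g * (n₁ * n₂)) +
        x₀ * y₀ * (n₁ * n₂)) =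
      (1 - g) ^ 2 * ((X * Y - x₀ * y₀ * c) ^ 2 - ((1 - x₀) * X ^ 2 + x₀ * X') * ((1 - y₀) * Y ^ 2 + y₀ * Y')) +
      g * (1 - g) * (x₀ * (1 - y₀) * (2 * (X * Y) * (n₁ + n₂ - n₁ * n₂) - (X' * Y ^ 2 + n₁ * n₂)) +
        y₀ * (1 - x₀) * (2 * (Y * X) * (n₁ + n₂ - n₁ * n₂) - (Y' * X ^ 2 + n₁ * n₂)) +
        2 * (x₀ * y₀) * ((n₁ + n₂ - n₁ * n₂) ^ 2 - n₁ * n₂)) +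
      g ^ 2 * ((1 - (1 - x₀) * (1 - y₀)) * ((n₁ + n₂ - n₁ * n₂) ^ 2 - n₁ * n₂)) := by
    rw [hX, hY, hX', hY', hn₁, hn₂, hc_def]; ring
  have t0 : 0 ≤ (1 - g) ^ 2 * ((X * Y - x₀ * y₀ * c) ^ 2 - ((1 - x₀) * X ^ 2 + x₀ * X') * ((1 - y₀) * Y ^ 2 + y₀ * Y')) :=
    mul_nonneg (sq_nonneg _) (sub_nonneg.2 hP0)
  have t01 : 0 ≤ g * (1 - g) * (x₀ * (1 - y₀) * (2 * (X * Y) * (n₁ + n₂ - n₁ * n₂) - (X' * Y ^ 2 + n₁ * n₂)) +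
      y₀ * (1 - x₀) * (2 * (Y * X) * (n₁ + n₂ - n₁ * n₂) - (Y' * X ^ 2 + n₁ * n₂)) +
      2 * (x₀ * y₀) * ((n₁ + n₂ - n₁ * n₂) ^ 2 - n₁ * n₂)) := by
    refine mul_nonneg (mul_nonneg hg (sub_nonneg.2 hg')) (add_nonneg (add_nonneg ?_ ?_) ?_)
    · refine mul_nonneg (mul_nonneg hx₀ (sub_nonneg.2 hy₀')) (sub_nonneg.2 ?_)
      have e1 : X' * Y ^ 2 + n₁ * n₂ = (1 - x₁) * (1 - x₂) * (1 - y₁ * y₂) ^ 2 + (1 - x₁) * (1 - y₁) * ((1 - x₂) * (1 - y₂)) := by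
        rw [hX', hY, hn₁, hn₂]
      rw [e1, hX, hY, hn₁, hn₂]; exact hXYN
    · refine mul_nonneg (mul_nonneg hy₀ (sub_nonneg.2 hx₀')) (sub_nonneg.2 ?_)
      have e1 : Y' * X ^ 2 + n₁ * n₂ = (1 - y₁) * (1 - y₂) * (1 - x₁ * x₂) ^ 2 + (1 - y₁) * (1 - x₁) * ((1 - y₂) * (1 - x₂)) := by
        rw [hY', hX, hn₁, hn₂]; ring
      have e2 : 2 * (Y * X) * (n₁ + n₂ - n₁ * n₂) = 2 * ((1 - y₁ * y₂) * (1 - x₁ * x₂)) *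
          ((1 - y₁) * (1 - x₁) + (1 - y₂) * (1 - x₂) - (1 - y₁) * (1 - x₁) * ((1 - y₂) * (1 - x₂))) := by
        rw [hY, hX, hn₁, hn₂]; ring
      rw [e1, e2]; exact hXYN'
    · exact mul_nonneg (mul_nonneg (by norm_num) (mul_nonneg hx₀ hy₀)) (sub_nonneg.2 hNN)
  have t1 : 0 ≤ g ^ 2 * ((1 - (1 - x₀) * (1 - y₀)) * ((n₁ + n₂ - n₁ * n₂) ^ 2 - n₁ * n₂)) :=
    mul_nonneg (sq_nonneg _) (mul_nonneg hn₀' (sub_nonneg.2 hNN))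
  have key : 0 ≤ ((1 - g) * (X * Y - x₀ * y₀ * c) + g * (n₁ + n₂ - n₁ * n₂)) ^ 2 -
      ((1 - x₀) * (1 - y₀) * ((1 - g) * (X * Y) + g * (n₁ + n₂ - n₁ * n₂)) ^ 2 +
        x₀ * (1 - y₀) * ((1 - g) * (X' * Y ^ 2) + g * (n₁ * n₂)) + (1 - x₀) * y₀ * ((1 - g) * (X ^ 2 * Y') + g * (n₁ * n₂)) +
        x₀ * y₀ * (n₁ * n₂)) := by rw [ident]; exact add_nonneg (add_nonneg t0 t01) t1
  have e3 : (1 - x₁) * (1 - x₂) * (1 - y₁ * y₂) ^ 2 = X' * Y ^ 2 := by rw [hX', hY]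
  have e4 : (1 - x₁ * x₂) ^ 2 * ((1 - y₁) * (1 - y₂)) = X ^ 2 * Y' := by rw [hX, hY']
  rw [e3, e4]
  linarith

/-- **Cauchy–Schwarz step with an external bridge**: `A(g)² ≤ B(g)·Λ(g)` (notation of the module docstring) — four weighted atoms
`(n₀, τ)`, `(x₀(1−y₀)(1−g)X', Y)`, `((1−x₀)y₀(1−g)Y', X)`, `(q·(g(x₀(1−y₀) + (1−x₀)y₀) + x₀y₀), 1)`. [folklore] -/
theorem bridge_cs (x₀ x₁ x₂ y₀ y₁ y₂ g : ℝ) (hx₀ : 0 ≤ x₀) (hx₀' : x₀ ≤ 1) (hx₁' : x₁ ≤ 1) (hx₂' : x₂ ≤ 1)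
    (hy₀ : 0 ≤ y₀) (hy₀' : y₀ ≤ 1) (hy₁' : y₁ ≤ 1) (hy₂' : y₂ ≤ 1) (hg : 0 ≤ g) (hg' : g ≤ 1) :
    ((1 - g) * ((1 - x₀ * x₁ - x₀ * x₂ - x₁ * x₂ + 2 * x₀ * x₁ * x₂) * (1 - y₀ * y₁ - y₀ * y₂ - y₁ * y₂ + 2 * y₀ * y₁ * y₂)) +
        g * ((1 - x₀) * (1 - y₀) * ((1 - x₁) * (1 - y₁)) + (1 - x₀) * (1 - y₀) * ((1 - x₂) * (1 - y₂)) +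
          (1 - x₁) * (1 - y₁) * ((1 - x₂) * (1 - y₂)) - 2 * ((1 - x₀) * (1 - y₀)) * ((1 - x₁) * (1 - y₁)) * ((1 - x₂) * (1 - y₂)))) ^ 2 ≤
      ((1 - g) * ((1 - x₀ * (x₁ + x₂ - x₁ * x₂)) * (1 - y₀ * (y₁ + y₂ - y₁ * y₂))) +
          g * ((1 - x₀) * (1 - y₀) + (1 - (1 - x₀) * (1 - y₀)) * ((1 - x₁) * (1 - y₁) * ((1 - x₂) * (1 - y₂))))) *
        ((1 - x₀) * (1 - y₀) * ((1 - g) * ((1 - x₁ * x₂) * (1 - y₁ * y₂)) +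
            g * ((1 - x₁) * (1 - y₁) + (1 - x₂) * (1 - y₂) - (1 - x₁) * (1 - y₁) * ((1 - x₂) * (1 - y₂)))) ^ 2 +
          x₀ * (1 - y₀) * ((1 - g) * ((1 - x₁) * (1 - x₂) * (1 - y₁ * y₂) ^ 2) + g * ((1 - x₁) * (1 - y₁) * ((1 - x₂) * (1 - y₂)))) +
          (1 - x₀) * y₀ * ((1 - g) * ((1 - x₁ * x₂) ^ 2 * ((1 - y₁) * (1 - y₂))) + g * ((1 - x₁) * (1 - y₁) * ((1 - x₂) * (1 - y₂)))) +
          x₀ * y₀ * ((1 - x₁) * (1 - y₁) * ((1 - x₂) * (1 - y₂)))) := by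
  set n₁ : ℝ := (1 - x₁) * (1 - y₁) with hn₁
  set n₂ : ℝ := (1 - x₂) * (1 - y₂) with hn₂
  set X : ℝ := 1 - x₁ * x₂ with hX
  set Y : ℝ := 1 - y₁ * y₂ with hY
  set X' : ℝ := (1 - x₁) * (1 - x₂) with hX'
  set Y' : ℝ := (1 - y₁) * (1 - y₂) with hY'
  have hX'0 : 0 ≤ X' := mul_nonneg (sub_nonneg.2 hx₁') (sub_nonneg.2 hx₂')
  have hY'0 : 0 ≤ Y' := mul_nonneg (sub_nonneg.2 hy₁') (sub_nonneg.2 hy₂')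
  have hq : 0 ≤ n₁ * n₂ := mul_nonneg (mul_nonneg (sub_nonneg.2 hx₁') (sub_nonneg.2 hy₁')) (mul_nonneg (sub_nonneg.2 hx₂') (sub_nonneg.2 hy₂'))
  have hW₁ : 0 ≤ (1 - x₀) * (1 - y₀) := mul_nonneg (sub_nonneg.2 hx₀') (sub_nonneg.2 hy₀')
  have hW₂ : 0 ≤ x₀ * (1 - y₀) * ((1 - g) * X') := mul_nonneg (mul_nonneg hx₀ (sub_nonneg.2 hy₀')) (mul_nonneg (sub_nonneg.2 hg') hX'0)
  have hW₃ : 0 ≤ (1 - x₀) * y₀ * ((1 - g) * Y') := mul_nonneg (mul_nonneg (sub_nonneg.2 hx₀') hy₀) (mul_nonneg (sub_nonneg.2 hg') hY'0)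
  have hW₄ : 0 ≤ n₁ * n₂ * (g * (x₀ * (1 - y₀) + (1 - x₀) * y₀) + x₀ * y₀) :=
    mul_nonneg hq (add_nonneg (mul_nonneg hg (add_nonneg (mul_nonneg hx₀ (sub_nonneg.2 hy₀')) (mul_nonneg (sub_nonneg.2 hx₀') hy₀)))
      (mul_nonneg hx₀ hy₀))
  have hcs := cs_atoms₄ _ _ _ _ ((1 - g) * (X * Y) + g * (n₁ + n₂ - n₁ * n₂)) Y X 1 hW₁ hW₂ hW₃ hW₄
  have eA : (1 - g) * ((1 - x₀ * x₁ - x₀ * x₂ - x₁ * x₂ + 2 * x₀ * x₁ * x₂) * (1 - y₀ * y₁ - y₀ * y₂ - y₁ * y₂ + 2 * y₀ * y₁ * y₂)) +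
      g * ((1 - x₀) * (1 - y₀) * n₁ + (1 - x₀) * (1 - y₀) * n₂ + n₁ * n₂ - 2 * ((1 - x₀) * (1 - y₀)) * n₁ * n₂) =
      (1 - x₀) * (1 - y₀) * ((1 - g) * (X * Y) + g * (n₁ + n₂ - n₁ * n₂)) + x₀ * (1 - y₀) * ((1 - g) * X') * Y +
        (1 - x₀) * y₀ * ((1 - g) * Y') * X + n₁ * n₂ * (g * (x₀ * (1 - y₀) + (1 - x₀) * y₀) + x₀ * y₀) * 1 := by
    rw [hX, hY, hX', hY', hn₁, hn₂]; ring
  have eB : (1 - g) * ((1 - x₀ * (x₁ + x₂ - x₁ * x₂)) * (1 - y₀ * (y₁ + y₂ - y₁ * y₂))) +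
      g * ((1 - x₀) * (1 - y₀) + (1 - (1 - x₀) * (1 - y₀)) * (n₁ * n₂)) =
      (1 - x₀) * (1 - y₀) + x₀ * (1 - y₀) * ((1 - g) * X') + (1 - x₀) * y₀ * ((1 - g) * Y') +
        n₁ * n₂ * (g * (x₀ * (1 - y₀) + (1 - x₀) * y₀) + x₀ * y₀) := by
    rw [hX', hY', hn₁, hn₂]; ring
  have eL : (1 - x₀) * (1 - y₀) * ((1 - g) * (X * Y) + g * (n₁ + n₂ - n₁ * n₂)) ^ 2 +
      x₀ * (1 - y₀) * ((1 - g) * (X' * Y ^ 2) + g * (n₁ * n₂)) + (1 - x₀) * y₀ * ((1 - g) * (X ^ 2 * Y') + g * (n₁ * n₂)) +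
      x₀ * y₀ * (n₁ * n₂) =
      (1 - x₀) * (1 - y₀) * ((1 - g) * (X * Y) + g * (n₁ + n₂ - n₁ * n₂)) ^ 2 + x₀ * (1 - y₀) * ((1 - g) * X') * Y ^ 2 +
        (1 - x₀) * y₀ * ((1 - g) * Y') * X ^ 2 + n₁ * n₂ * (g * (x₀ * (1 - y₀) + (1 - x₀) * y₀) + x₀ * y₀) * 1 ^ 2 := by ring
  have e3 : (1 - x₁) * (1 - x₂) * (1 - y₁ * y₂) ^ 2 = X' * Y ^ 2 := by rw [hX', hY]
  have e4 : (1 - x₁ * x₂) ^ 2 * ((1 - y₁) * (1 - y₂)) = X ^ 2 * Y' := by rw [hX, hY']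
  rw [e3, e4, eA, eB, eL]
  exact hcs

/-- **The two-pole polynomial inequality with an external bridge (DUU on the core)**: `A(g)² ≤ B(g)·C(g)²` for all variables in `[0,1]`
(notation of the module docstring); `g = 0` is `Consts.TwoPole.poly_DUU`, `g = 1` the star inequality at the merged pole. [folklore] -/
theorem poly_DUU_bridge (x₀ x₁ x₂ y₀ y₁ y₂ g : ℝ) (hx₀ : 0 ≤ x₀) (hx₀' : x₀ ≤ 1) (hx₁ : 0 ≤ x₁) (hx₁' : x₁ ≤ 1) (hx₂ : 0 ≤ x₂)
    (hx₂' : x₂ ≤ 1) (hy₀ : 0 ≤ y₀) (hy₀' : y₀ ≤ 1) (hy₁ : 0 ≤ y₁) (hy₁' : y₁ ≤ 1) (hy₂ : 0 ≤ y₂) (hy₂' : y₂ ≤ 1) (hg : 0 ≤ g)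
    (hg' : g ≤ 1) :
    ((1 - g) * ((1 - x₀ * x₁ - x₀ * x₂ - x₁ * x₂ + 2 * x₀ * x₁ * x₂) * (1 - y₀ * y₁ - y₀ * y₂ - y₁ * y₂ + 2 * y₀ * y₁ * y₂)) +
        g * ((1 - x₀) * (1 - y₀) * ((1 - x₁) * (1 - y₁)) + (1 - x₀) * (1 - y₀) * ((1 - x₂) * (1 - y₂)) +
          (1 - x₁) * (1 - y₁) * ((1 - x₂) * (1 - y₂)) - 2 * ((1 - x₀) * (1 - y₀)) * ((1 - x₁) * (1 - y₁)) * ((1 - x₂) * (1 - y₂)))) ^ 2 ≤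
      ((1 - g) * ((1 - x₀ * (x₁ + x₂ - x₁ * x₂)) * (1 - y₀ * (y₁ + y₂ - y₁ * y₂))) +
          g * ((1 - x₀) * (1 - y₀) + (1 - (1 - x₀) * (1 - y₀)) * ((1 - x₁) * (1 - y₁) * ((1 - x₂) * (1 - y₂))))) *
        ((1 - g) * ((1 - x₁ * x₂) * (1 - y₁ * y₂) - x₀ * y₀ * (x₁ * (1 - y₁) * (1 - x₂) * y₂ + (1 - x₁) * y₁ * x₂ * (1 - y₂))) +
          g * ((1 - x₁) * (1 - y₁) + (1 - x₂) * (1 - y₂) - (1 - x₁) * (1 - y₁) * ((1 - x₂) * (1 - y₂)))) ^ 2 := by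
  have hcs := bridge_cs x₀ x₁ x₂ y₀ y₁ y₂ g hx₀ hx₀' hx₁' hx₂' hy₀ hy₀' hy₁' hy₂' hg hg'
  have hkey := bridge_key_le x₀ x₁ x₂ y₀ y₁ y₂ g hx₀ hx₀' hx₁ hx₁' hx₂ hx₂' hy₀ hy₀' hy₁ hy₁' hy₂ hy₂' hg hg'
  have hX' : 0 ≤ (1 - x₁) * (1 - x₂) := mul_nonneg (sub_nonneg.2 hx₁') (sub_nonneg.2 hx₂')
  have hY' : 0 ≤ (1 - y₁) * (1 - y₂) := mul_nonneg (sub_nonneg.2 hy₁') (sub_nonneg.2 hy₂')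
  have hDx : 0 ≤ 1 - x₀ * (x₁ + x₂ - x₁ * x₂) := by
    have e : 1 - x₀ * (x₁ + x₂ - x₁ * x₂) = (1 - x₀) + x₀ * ((1 - x₁) * (1 - x₂)) := by ring
    rw [e]; exact add_nonneg (sub_nonneg.2 hx₀') (mul_nonneg hx₀ hX')
  have hDy : 0 ≤ 1 - y₀ * (y₁ + y₂ - y₁ * y₂) := by
    have e : 1 - y₀ * (y₁ + y₂ - y₁ * y₂) = (1 - y₀) + y₀ * ((1 - y₁) * (1 - y₂)) := by ring
    rw [e]; exact add_nonneg (sub_nonneg.2 hy₀') (mul_nonneg hy₀ hY')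
  have hn₀ : 0 ≤ (1 - x₀) * (1 - y₀) := mul_nonneg (sub_nonneg.2 hx₀') (sub_nonneg.2 hy₀')
  have hn₀' : 0 ≤ 1 - (1 - x₀) * (1 - y₀) := sub_nonneg.2 (mul_le_one₀ (sub_le_self _ hx₀) (sub_nonneg.2 hy₀') (sub_le_self _ hy₀))
  have hq : 0 ≤ (1 - x₁) * (1 - y₁) * ((1 - x₂) * (1 - y₂)) :=
    mul_nonneg (mul_nonneg (sub_nonneg.2 hx₁') (sub_nonneg.2 hy₁')) (mul_nonneg (sub_nonneg.2 hx₂') (sub_nonneg.2 hy₂'))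
  have hB : 0 ≤ (1 - g) * ((1 - x₀ * (x₁ + x₂ - x₁ * x₂)) * (1 - y₀ * (y₁ + y₂ - y₁ * y₂))) +
      g * ((1 - x₀) * (1 - y₀) + (1 - (1 - x₀) * (1 - y₀)) * ((1 - x₁) * (1 - y₁) * ((1 - x₂) * (1 - y₂)))) :=
    add_nonneg (mul_nonneg (sub_nonneg.2 hg') (mul_nonneg hDx hDy)) (mul_nonneg hg (add_nonneg hn₀ (mul_nonneg hn₀' hq)))
  exact hcs.trans (mul_le_mul_of_nonneg_left hkey hB)

/-- `0 ≤ C(g) = (1−g)M + gN`. [folklore] -/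
theorem C_bridge_nonneg (x₀ x₁ x₂ y₀ y₁ y₂ g : ℝ) (hx₀ : 0 ≤ x₀) (hx₀' : x₀ ≤ 1) (hx₁ : 0 ≤ x₁) (hx₁' : x₁ ≤ 1) (hx₂ : 0 ≤ x₂)
    (hx₂' : x₂ ≤ 1) (hy₀ : 0 ≤ y₀) (hy₀' : y₀ ≤ 1) (hy₁ : 0 ≤ y₁) (hy₁' : y₁ ≤ 1) (hy₂ : 0 ≤ y₂) (hy₂' : y₂ ≤ 1) (hg : 0 ≤ g)
    (hg' : g ≤ 1) :
    0 ≤ (1 - g) * ((1 - x₁ * x₂) * (1 - y₁ * y₂) - x₀ * y₀ * (x₁ * (1 - y₁) * (1 - x₂) * y₂ + (1 - x₁) * y₁ * x₂ * (1 - y₂))) +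
      g * ((1 - x₁) * (1 - y₁) + (1 - x₂) * (1 - y₂) - (1 - x₁) * (1 - y₁) * ((1 - x₂) * (1 - y₂))) := by
  have hM := M_nonneg x₀ x₁ x₂ y₀ y₁ y₂ hx₀ hx₀' hx₁ hx₁' hx₂ hx₂' hy₀ hy₀' hy₁ hy₁' hy₂ hy₂'
  have hn₁ : 0 ≤ (1 - x₁) * (1 - y₁) := mul_nonneg (sub_nonneg.2 hx₁') (sub_nonneg.2 hy₁')
  have hn₂ : 0 ≤ (1 - x₂) * (1 - y₂) := mul_nonneg (sub_nonneg.2 hx₂') (sub_nonneg.2 hy₂')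
  have hn₁1 : (1 - x₁) * (1 - y₁) ≤ 1 := mul_le_one₀ (sub_le_self _ hx₁) (sub_nonneg.2 hy₁') (sub_le_self _ hy₁)
  have hN : 0 ≤ (1 - x₁) * (1 - y₁) + (1 - x₂) * (1 - y₂) - (1 - x₁) * (1 - y₁) * ((1 - x₂) * (1 - y₂)) := by
    have h := mul_nonneg hn₂ (sub_nonneg.2 hn₁1)
    have e : (1 - x₂) * (1 - y₂) * (1 - (1 - x₁) * (1 - y₁)) =
        (1 - x₂) * (1 - y₂) - (1 - x₁) * (1 - y₁) * ((1 - x₂) * (1 - y₂)) := by ring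
    linarith [hn₁]
  exact add_nonneg (mul_nonneg (sub_nonneg.2 hg') hM) (mul_nonneg hg hN)

end TwoPole

end Consts

end Summit.CriticalPhenomena.PercolationContinuityZ3.Theorems
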